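import Mathlib.Analysis.SpecialFunctions.Pow.Real
import Summits.KontsevichZagierPeriods.KontsevichZagierPeriods.Theorems.SymplecticScissorsVolumeFormOffPlaneTriToBox

/-!
# Crux `VolumeFormOffPlane` (stmt-KontsevichZagierPeriods-14935) — line `Sketch`,
stub `stub_simplexToBox` (the divided power: log-simplex ~ log-box in every dimension)

Box-dimension `n + 1` (total dimension `n + 2`), box coordinates `x_ι = p (Fin.castSucc ι)`, slack
`z = p (Fin.last (n + 1))` with `0 < z ∧ z · ∏ x_ι < 1`. The LOG-SIMPLEX
`S(a; c) = {a_ι < x_ι, ∏ x_ι < c, slack}` is, in logarithmic coordinates, the simplex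
`{u_ι > log a_ι, ∑ u_ι < log c}` of volume `(log g)ⁿ⁺¹ / (n+1)!`, `g = c / ∏ a_ι`; the LOG-BOX over
`a` with edge ratios `(γ, g, …, g)`, `γ = g^{1/(n+1)!}`, has the same volume. `stub_simplexToBox`:
GIVEN the four registered stubs `stub_simplexExists`, `stub_orderCellPerm`, `stub_cubeDecomposition`,
`stub_cumprodMove`, the two integrand-`1` representations are KZ-equivalent. Chain in
`FormalRep ⧸ relations`: `[S(a; c)] = [S(1; g)]` (diagonal move `diag(a, (∏ a)⁻¹)`, landed
`ttb_diag_move`), `[S(1; g)] = [O_id(g)]` (cumulative-product move), `[O_σ(g)] = [O_id(g)]` for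
every permutation `σ` (reindex move) so `∑_σ [O_σ] = (n+1)! • [O_id]`, `[cube(g)] = ∑_σ [O_σ]`
(cube decomposition), `[cube(g)] = (n+1)! • [box(γ, g, …, g)]` (box stacking, landed `toric_pow`),
torsion-freeness (landed `MultiplicationAccessible.Negative.mem_relations_of_nsmul_mem_relations`),
and the landed scaling move `stub_logBoxLinear`.

Sources: M. Kontsevich, D. Zagier, *Periods* (2001), §1.2 (the moves); the dissection of the cube
into order simplices is classical (Hilbert's third problem bookkeeping); folklore.
-/

noncomputable section

open MeasureTheory Set
open Literature.NumberTheory.Transcendental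

namespace Summit.KontsevichZagierPeriods.SymplecticScissors.LogPolytope

/-- **Stub (lead; the divided power: log-simplex ~ log-box in every dimension).** Given the four
stubs `stub_simplexExists`, `stub_orderCellPerm`, `stub_cubeDecomposition`, `stub_cumprodMove`:
for positive real-algebraic `a_ι`, `c` real algebraic with `∏ a_ι < c`, the log-simplex
`{a_ι < x_ι, ∏ x_ι < c}` is KZ-equivalent to the log-box over `a` with edge ratios `(γ, g, …, g)`,
`g = c / ∏ a_ι`, `γ = g^{1/(n+1)!}` (both with slack). [folklore] -/
theorem stub_simplexToBox : (∀ (n : ℕ) (g : ℝ), IsAlgebraic ℚ g → (∃ r : KZ.IntegralRep (n + 1), r.domain = {p : Fin ((n) + 1) → ℝ | (∀ ι : Fin (n), 1 < p (Fin.castSucc ι)) ∧ ∏ ι : Fin (n), p (Fin.castSucc ι) < g ∧ 0 < p (Fin.last (n)) ∧ p (Fin.last (n)) * ∏ ι : Fin (n), p (Fin.castSucc ι) < 1} ∧ r.integrand = fun _ => 1) ∧ (∀ σ : Equiv.Perm (Fin n), ∃ r : KZ.IntegralRep (n + 1), r.domain = {p : Fin ((n) + 1) → ℝ | StrictMono (fun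 ι : Fin (n) => p (Fin.castSucc (σ ι))) ∧ (∀ ι : Fin (n), 1 < p (Fin.castSucc ι) ∧ p (Fin.castSucc ι) < g) ∧ 0 < p (Fin.last (n)) ∧ p (Fin.last (n)) * ∏ ι : Fin (n), p (Fin.castSucc ι) < 1} ∧ r.integrand = fun _ => 1)) → (∀ (n : ℕ) (g : ℝ) (σ : Equiv.Perm (Fin n)) (r r' : KZ.IntegralRep (n + 1)), r.domain = {p : Fin ((n) + 1) → ℝ | StrictMono (fun ι : Fin (n) => p (Fin.castSucc ι)) ∧ (∀ ι : Fin (n), 1 < p (Fin.castSucc ι) ∧ p (Fin.castSucc ι) < g) ∧ 0 < p (Fin.last (n)) ∧ p (Fin.last (n)) * ∏ ι : Fin (n), p (Fin.castSucc ι) < 1} → r'.domain = {p : Fin ((n) + 1) → ℝ | StrictMono (fun ι : Fin (n) => p (Fin.castSucc (σ ι))) ∧ (∀ ι : Fin (n), 1 < p (Fin.castSucc ι) ∧ p (Fin.castSucc ι) < g) ∧ 0 < p (Fin.last (n)) ∧ p (Fin.last (n)) * ∏ ι : Fin (n), p (Fin.castSucc ι) < 1} → (∀ p ∈ r.domain,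 r.integrand p = 1) → (∀ p ∈ r'.domain, r'.integrand p = 1) → KZ.of r - KZ.of r' ∈ KZ.relations) → (∀ (n : ℕ) (g : ℝ) (r : KZ.IntegralRep (n + 1)) (R : Equiv.Perm (Fin n) → KZ.IntegralRep (n + 1)), r.domain = {p : Fin ((n) + 1) → ℝ | (∀ ι : Fin (n), 1 < p (Fin.castSucc ι) ∧ p (Fin.castSucc ι) < g) ∧ 0 < p (Fin.last (n)) ∧ p (Fin.last (n)) * ∏ ι : Fin (n), p (Fin.castSucc ι) < 1} → (∀ σ, (R σ).domain = {p : Fin ((n) + 1) → ℝ | StrictMono (fun ι : Fin (n) => p (Fin.castSucc (σ ι))) ∧ (∀ ι : Fin (n), 1 < p (Fin.castSucc ι) ∧ p (Fin.castSucc ι) < g) ∧ 0 < p (Fin.last (n)) ∧ p (Fin.last (n)) * ∏ ι : Fin (n), p (Fin.castSucc ι) < 1}) → (∀ p ∈ r.domain, r.integrand p = 1) → (∀ σ, ∀ p ∈ (R σ).domain, (R σ).integrand p = 1) → KZ.of r - ∑ σ, KZ.of (R σ) ∈ KZ.relations) → (∀ (n : ℕ) (g : ℝ) (r r' : KZ.IntegralRep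 (n + 1 + 1)), r.domain = {p : Fin ((n + 1) + 1) → ℝ | (∀ ι : Fin (n + 1), 1 < p (Fin.castSucc ι)) ∧ ∏ ι : Fin (n + 1), p (Fin.castSucc ι) < g ∧ 0 < p (Fin.last (n + 1)) ∧ p (Fin.last (n + 1)) * ∏ ι : Fin (n + 1), p (Fin.castSucc ι) < 1} → r'.domain = {p : Fin ((n + 1) + 1) → ℝ | StrictMono (fun ι : Fin (n + 1) => p (Fin.castSucc ι)) ∧ (∀ ι : Fin (n + 1), 1 < p (Fin.castSucc ι) ∧ p (Fin.castSucc ι) < g) ∧ 0 < p (Fin.last (n + 1)) ∧ p (Fin.last (n + 1)) * ∏ ι : Fin (n + 1), p (Fin.castSucc ι) < 1} → (∀ p ∈ r.domain, r.integrand p = 1) → (∀ p ∈ r'.domain, r'.integrand p = 1) → KZ.of r - KZ.of r' ∈ KZ.relations) → (∀ (n : ℕ) (a : Fin (n + 1) → ℝ) (c : ℝ), (∀ ι, 0 < a ι) → (∀ ι, IsAlgebraic ℚ (a ι)) → IsAlgebraic ℚ c → ∏ ι, a ι < c → ∀ (r r' : KZ.IntegralRep (n + 1 + 1)), r.domain =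 {p : Fin ((n + 1) + 1) → ℝ | (∀ ι : Fin (n + 1), (a) ι < p (Fin.castSucc ι)) ∧ ∏ ι : Fin (n + 1), p (Fin.castSucc ι) < c ∧ 0 < p (Fin.last (n + 1)) ∧ p (Fin.last (n + 1)) * ∏ ι : Fin (n + 1), p (Fin.castSucc ι) < 1} → r'.domain = {p : Fin ((n + 1) + 1) → ℝ | (∀ ι : Fin (n + 1), (a) ι < p (Fin.castSucc ι) ∧ p (Fin.castSucc ι) < (fun ι => a ι * Function.update (fun _ : Fin (n + 1) => c / ∏ κ, a κ) 0 ((c / ∏ κ, a κ) ^ (((n + 1).factorial : ℝ)⁻¹)) ι) ι) ∧ 0 < p (Fin.last (n + 1)) ∧ p (Fin.last (n + 1)) * ∏ ι : Fin (n + 1), p (Fin.castSucc ι) < 1} → (∀ p ∈ r.domain, r.integrand p = 1) → (∀ p ∈ r'.domain, r'.integrand p = 1) → KZ.of r - KZ.of r' ∈ KZ.relations) := by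
  intro hSEx hPerm hDec hCum n a c ha haa hca hlt r r' hrd hr'd hr hr'
  -- integrand-one bookkeeping
  have hio : ∀ {N : ℕ} {s : KZ.IntegralRep N}, (s.integrand = fun _ => 1) →
      ∀ p ∈ s.domain, s.integrand p = 1 := fun h p _ => by rw [h]
  -- the parameters
  set P : ℝ := ∏ ι, a ι with hP
  have hP0 : 0 < P := Finset.prod_pos fun ι _ => ha ι
  have hPa : IsAlgebraic ℚ P := lbl_isAlgebraic_prod haa
  set g : ℝ := c / P with hg
  have hg1 : 1 < g := (one_lt_div hP0).mpr hlt
  have hg0 : 0 < g := one_pos.trans hg1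
  have hga : IsAlgebraic ℚ g := by rw [hg, div_eq_mul_inv]; exact hca.mul hPa.inv
  set Nf : ℕ := (n + 1).factorial with hNf
  have hNf0 : Nf ≠ 0 := Nat.factorial_ne_zero _
  set γ : ℝ := g ^ ((Nf : ℝ)⁻¹) with hγ
  have hγ1 : 1 < γ := Real.one_lt_rpow hg1 (by positivity)
  have hγN : γ ^ Nf = g := Real.rpow_inv_natCast_pow hg0.le hNf0
  have hγa : IsAlgebraic ℚ γ := IsAlgebraic.of_pow (Nat.pos_of_ne_zero hNf0) (by rw [hγN]; exact hga)
  -- the representations supplied by `stub_simplexExists` and `stub_logBoxCut`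
  obtain ⟨S₁, hS₁d, hS₁i⟩ := (hSEx (n + 1) g hga).1
  choose O hOd hOi using (hSEx (n + 1) g hga).2
  have hOidd := hOd 1
  simp only [Equiv.Perm.coe_one, id_eq] at hOidd
  obtain ⟨Qc, hQcd, hQci⟩ := stub_logBoxCut.1 (n + 1) (fun _ => (1:ℝ))
    (Function.update (fun _ : Fin (n + 1) => g) 0 (γ ^ Nf)) (fun _ => one_pos)
    (fun _ => isAlgebraic_one) (toric_update_algebraic (fun _ => hga) 0 (hγa.pow Nf))
  obtain ⟨B₁, hB₁d, hB₁i⟩ := stub_logBoxCut.1 (n + 1) (fun _ => (1:ℝ))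
    (Function.update (fun _ : Fin (n + 1) => g) 0 γ) (fun _ => one_pos)
    (fun _ => isAlgebraic_one) (toric_update_algebraic (fun _ => hga) 0 hγa)
  -- Step 1: normalise the simplex to the corner 1 by `diag(a, P⁻¹)`
  have h1 : KZ.of S₁ - KZ.of r ∈ KZ.relations := by
    refine ttb_diag_move (Fin.snoc a P⁻¹) ?_ ?_ ?_ S₁ r ?_ (hio hS₁i) hr
    · intro k
      induction k using Fin.lastCases with
      | last => rw [Fin.snoc_last]; positivity
      | cast ι => rw [Fin.snoc_castSucc]; exact (ha ι).ne'
    · intro k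
      induction k using Fin.lastCases with
      | last => rw [Fin.snoc_last]; exact hPa.inv
      | cast ι => rw [Fin.snoc_castSucc]; exact haa ι
    · rw [Fin.prod_univ_castSucc]
      simp only [Fin.snoc_castSucc, Fin.snoc_last]
      rw [← hP, mul_inv_cancel₀ hP0.ne', abs_one]
    · rw [hrd, hS₁d]
      ext q
      simp only [mem_setOf_eq, Fin.snoc_castSucc, Fin.snoc_last, inv_inv]
      have e1 : ∀ ι, 1 < (a ι)⁻¹ * q (Fin.castSucc ι) ↔ a ι < q (Fin.castSucc ι) := fun ι => by
        rw [lt_inv_mul_iff₀ (ha ι), mul_one]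
      have e3 : ∏ ι, (a ι)⁻¹ * q (Fin.castSucc ι) = (∏ ι, q (Fin.castSucc ι)) / P := by
        rw [Finset.prod_mul_distrib, Finset.prod_inv_distrib, ← hP, div_eq_inv_mul]
      have e4 : 0 < P * q (Fin.last (n + 1)) ↔ 0 < q (Fin.last (n + 1)) :=
        mul_pos_iff_of_pos_left hP0
      have e5 : P * q (Fin.last (n + 1)) * ((∏ ι, q (Fin.castSucc ι)) / P) =
          q (Fin.last (n + 1)) * ∏ ι, q (Fin.castSucc ι) := by
        field_simp
      simp only [e1, e3, e4, e5]
      rw [hg, div_lt_div_iff_of_pos_right hP0]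
  -- Step 2: the cumulative-product move `[S(1; g)] = [O_id(g)]`
  have h2 : KZ.of S₁ - KZ.of (O 1) ∈ KZ.relations :=
    hCum n g S₁ (O 1) hS₁d hOidd (hio hS₁i) (hio (hOi 1))
  -- Step 3: every order cell has the class of `O_id`
  set π := QuotientAddGroup.mk' KZ.relations with hπ
  have e3 : ∀ σ, π (KZ.of (O σ)) = π (KZ.of (O 1)) := fun σ =>
    (toric_mk_eq_iff.mpr (hPerm (n + 1) g σ (O 1) (O σ) hOidd (hOd σ) (hio (hOi 1))
      (hio (hOi σ)))).symm
  -- Step 4: the cube is the sum of its order cells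
  have hupdN : Function.update (fun _ : Fin (n + 1) => g) 0 (γ ^ Nf) = fun _ => g := by
    rw [hγN]; exact Function.update_eq_self 0 _
  have hQc' : Qc.domain = {p : Fin ((n + 1) + 1) → ℝ | (∀ ι : Fin (n + 1), 1 < p (Fin.castSucc ι) ∧
      p (Fin.castSucc ι) < g) ∧ 0 < p (Fin.last (n + 1)) ∧
      p (Fin.last (n + 1)) * ∏ ι : Fin (n + 1), p (Fin.castSucc ι) < 1} := by
    rw [hQcd, hupdN]
  have h4 : KZ.of Qc - ∑ σ, KZ.of (O σ) ∈ KZ.relations :=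
    hDec (n + 1) g Qc O hQc' hOd (hio hQci) (fun σ => hio (hOi σ))
  have e4 : π (KZ.of Qc) = Nf • π (KZ.of (O 1)) := by
    rw [toric_mk_eq_iff.mpr h4, map_sum, Finset.sum_congr rfl fun σ _ => e3 σ, Finset.sum_const,
      Finset.card_univ, Fintype.card_perm, Fintype.card_fin]
  -- Step 5: box stacking `[cube(g)] = (n+1)! • [box(γ, g, …, g)]`
  have e5 : π (KZ.of Qc) = Nf • π (KZ.of B₁) :=
    toric_pow stub_logBoxCut.1 stub_logBoxCut.2 stub_logBoxLinear.1 (fun _ => g) (fun _ => hga) 0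
      hγ1 hγa B₁ hB₁d (hio hB₁i) Nf Qc hQcd (hio hQci)
  -- Step 6: divide by `(n+1)!`
  have e6 : KZ.of (O 1) - KZ.of B₁ ∈ KZ.relations := by
    refine Summit.KontsevichZagierPeriods.MultiplicationAccessible.Negative.mem_relations_of_nsmul_mem_relations
      hNf0 ?_
    rw [nsmul_sub]
    exact toric_mk_eq_iff.mp (by rw [map_nsmul, map_nsmul, ← e4, e5])
  -- Step 7: un-normalise the box to the corner `a` by the scaling move
  have h7 : KZ.of B₁ - KZ.of r' ∈ KZ.relations := by
    refine stub_logBoxLinear.1 (n + 1) (fun _ => (1:ℝ)) (Function.update (fun _ : Fin (n + 1) => g) 0 γ)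
      a ha haa B₁ r' hB₁d ?_ (hio hB₁i) hr'
    rw [hr'd]
    ext p
    simp only [mem_setOf_eq, mul_one]
  -- assemble
  have : KZ.of r - KZ.of r' =
      (KZ.of S₁ - KZ.of (O 1)) + (KZ.of (O 1) - KZ.of B₁) + (KZ.of B₁ - KZ.of r') -
        (KZ.of S₁ - KZ.of r) := by abel
  rw [this]
  exact KZ.relations.sub_mem (KZ.relations.add_mem (KZ.relations.add_mem h2 e6) h7) h1

end Summit.KontsevichZagierPeriods.SymplecticScissors.LogPolytope

end
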